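import Summits.Ventures.LatticeQCDFlow.Exactness.IMHCommonRandomNumbersMeetingTimeTwoStarts
import HarnessLib

/-!
# The two-starts law WITH ATOMS (finite gauge groups): from an ordered off-diagonal pair the disagreement probability after one update is
# EXACTLY `1 − A(heavier)`, hence `P(X_n ≠ X′_n) = (1 − A(x))ⁿ·P(X′_0 ≠ x)` and `Σ_n P(X_n ≠ X′_n) = P(X′_0 ≠ x)/A(x)` for every proposal

HONEST FRAMING: exact (Metropolis-corrected) sampling algorithms for lattice gauge theory;
figures of merit are autocorrelation/cost numbers at stated couplings and volumes; no
continuum-physics claim.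

Venture `LatticeQCDFlow` (cell pub-lqcd), topic `Exactness`; FANOUT row 30 (lean-1, GEN-40).  NEW WORK of the cell, general state space
with `MeasurableEq Ω` — NO atom-freeness, NO singleton measurability beyond `MeasurableEq`; sequel to GEN-39's
`Exactness/IMHCommonRandomNumbersMeetingTimeTwoStarts` (the same law `P(X_n ≠ X′_n) = (1 − A(x))ⁿ` under the hypothesis `q{x} = 0`,
via GEN-31's atom-free holding law `Kᵗ(x, {x}) = (1 − A(x))ᵗ`; «NOT CLAIMED: proposals with atoms (finite `G`)» of GEN-39's lists).
With an atom at `x` the heavier run can «accept» the proposal `x` and stay, so `P(X_n = x) ≠ (1 − A(x))ⁿ`; but the DISAGREEMENT event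
does not care: from an ordered off-diagonal pair `z = (x, x′)` the pair is still off the diagonal after one common-random-numbers update
EXACTLY WHEN THE HEAVIER RUN REJECTS (`u·w(x) > w(y)`; a rejected proposal is never `x` itself since `u ≤ 1`), an event of probability
`1 − A(x)` whatever the atoms of `q`.  Setting: CRN pair kernel `K̂` of `K = indepMH q w` (`0 < w` measurable), `A = imhAcceptMass q w`;
initial coupling `μ̂₀` with FIRST RUN AT `x` (`μ̂₀∘fst⁻¹ = δ_x`) and SECOND RUN LIGHTER OR EQUAL (`μ̂₀{w(X′_0) ≤ w(X_0)} = 1`):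

* §1 **`crnPair_apply_offDiagonal_eq_of_ordered`** — for `z.1 ≠ z.2`, `w z.2 ≤ w z.1`: `K̂ z (Δᶜ) = 1 − A(z.1)` EXACTLY (every `q`).
* §2 **`iterate_bind_crnPair_offDiagonal_eq_holding_atoms`** — `(μ̂₀K̂ⁿ)(Δᶜ) = (1 − A(x))ⁿ·μ̂₀(Δᶜ)` for every `n` (induction with GEN-39's
  «off the diagonal the first run is at `x`» and GEN-36's dominance); **`iterate_bind_crnPair_offDiagonal_eq_holding_atoms'`** — the same with
  `μ̂₀(Δᶜ) = μ̂₀∘snd⁻¹({x}ᶜ) = P(X′_0 ≠ x)`.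
* §3 **`tsum_iterate_bind_crnPair_offDiagonal_eq_atoms`** — `Σ_n (μ̂₀K̂ⁿ)(Δᶜ) = μ̂₀(Δᶜ)·A(x)⁻¹` (`ℝ≥0∞`): THE EXPECTED TOTAL DISAGREEMENT TIME
  FROM TWO STARTS IS `P(X′_0 ≠ x)/A(x)` FOR EVERY PROPOSAL LAW — purely atomic ones (finite gauge groups `ℤ_N`, finite `G`) included;
  **`crn_chain_totalDisagreement_tail_eq_twoStarts_atoms`** — with a normalised weight maximal somewhere (automatic for finite `G`),
  `P(T ≥ t) = (1 − A(x))^{t−1}·μ̂₀(Δᶜ)` (GEN-39's every-coupling tail identity).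
Reading (gauge files): two exact samplers of a FINITE gauge group on one stream of random numbers, started from two fixed configurations,
differ for a geometric number of updates with parameter the acceptance probability at the heavier start — the same law as for Lie groups.
NOT CLAIMED here: the any-coupling law with atoms (it is the sequel `…MeetingTimeAnyCouplingAtoms`); the swap-symmetric mirror statements
(they follow as in GEN-39 §4, not re-typed).  No `sorry`, no new definitions, nothing cited as a fact.
-/

noncomputable section

namespace Summit.Ventures.LatticeQCDFlow.Exactness

open MeasureTheory ProbabilityTheory Function Finset Filter Set
open scoped _root_.ENNReal unitInterval Topology
open Summit.Ventures.LatticeQCDFlow.Scoring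

variable {Ω : Type*} [MeasurableSpace Ω] {q : Measure Ω} [IsProbabilityMeasure q] {w : Ω → ℝ}

/-! ## §1 One update from an ordered off-diagonal pair: off the diagonal exactly when the heavier run rejects -/

/-- **`K̂ z (Δᶜ) = 1 − A(z.1)` EXACTLY** from an ordered off-diagonal pair (`z.1 ≠ z.2`, `w z.2 ≤ w z.1`), for EVERY proposal law `q`
(atoms allowed): the runs still differ after the update iff the heavier run rejects, `u·w(z.1) > w(y)`. [ours] -/
theorem crnPair_apply_offDiagonal_eq_of_ordered [MeasurableEq Ω] (hw : Measurable w) (hw0 : ∀ y, 0 < w y)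
    (Khat : Kernel (Ω × Ω) (Ω × Ω))
    (hK : ∀ z : Ω × Ω, Khat z = (q.prod (volume : Measure unitInterval)).map (fun p : Ω × unitInterval =>
      ((if (p.2 : ℝ) * w z.1 ≤ w p.1 then p.1 else z.1), (if (p.2 : ℝ) * w z.2 ≤ w p.1 then p.1 else z.2))))
    {z : Ω × Ω} (hne : z.1 ≠ z.2) (hle : w z.2 ≤ w z.1) :
    Khat z (Set.diagonal Ω)ᶜ = 1 - imhAcceptMass q w z.1 := by
  have hD : MeasurableSet (Set.diagonal Ω) := measurableSet_diagonal
  rw [hK z, Measure.map_apply (measurable_crnPairUpdate_apply hw z) hD.compl]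
  -- the preimage of `Δᶜ` is the rejection event of the heavier run
  have hpre : (fun p : Ω × unitInterval =>
      ((if (p.2 : ℝ) * w z.1 ≤ w p.1 then p.1 else z.1), (if (p.2 : ℝ) * w z.2 ≤ w p.1 then p.1 else z.2))) ⁻¹' (Set.diagonal Ω)ᶜ =
      {p : Ω × unitInterval | ¬ ((p.2 : ℝ) * w z.1 ≤ w p.1)} := by
    ext p
    simp only [Set.mem_preimage, Set.mem_compl_iff, Set.mem_diagonal_iff, Set.mem_setOf_eq]
    by_cases h1 : (p.2 : ℝ) * w z.1 ≤ w p.1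
    · -- the heavier run accepts, hence so does the lighter one: merged
      have h2 : (p.2 : ℝ) * w z.2 ≤ w p.1 := (mul_le_mul_of_nonneg_left hle p.2.2.1).trans h1
      simp [h1, h2]
    · -- the heavier run rejects and stays at `z.1`; the other run is at `y ≠ z.1` or at `z.2 ≠ z.1`
      simp only [h1, if_false, not_false_eq_true, iff_true]
      by_cases h2 : (p.2 : ℝ) * w z.2 ≤ w p.1
      · rw [if_pos h2]
        intro hy
        apply h1
        rw [← hy]
        calc (p.2 : ℝ) * w z.1 ≤ 1 * w z.1 := mul_le_mul_of_nonneg_right p.2.2.2 (hw0 _).le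
          _ = w z.1 := one_mul _
      · rw [if_neg h2]
        exact hne
  rw [hpre]
  have hS : MeasurableSet {p : Ω × unitInterval | ¬ ((p.2 : ℝ) * w z.1 ≤ w p.1)} :=
    (measurableSet_le ((measurable_subtype_coe.comp measurable_snd).mul measurable_const) (hw.comp measurable_fst)).compl
  rw [Measure.prod_apply hS]
  have hsec : ∀ y, (volume : Measure unitInterval) (Prod.mk y ⁻¹' {p : Ω × unitInterval | ¬ ((p.2 : ℝ) * w z.1 ≤ w p.1)}) =
      1 - imhAcceptE w z.1 y := fun y => volume_unitInterval_reject hw0 z.1 y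
  simp_rw [hsec]
  have hax : Measurable (imhAcceptE w z.1) := (measurable_imhAcceptE hw).comp measurable_prodMk_left
  have hfin : ∫⁻ a, imhAcceptE w z.1 a ∂q ≠ ⊤ := by
    refine ne_top_of_le_ne_top ENNReal.one_ne_top ?_
    calc ∫⁻ a, imhAcceptE w z.1 a ∂q ≤ ∫⁻ _, 1 ∂q := lintegral_mono fun y => imhAcceptE_le_one w z.1 y
      _ = 1 := by rw [lintegral_const, measure_univ, mul_one]
  rw [lintegral_sub hax hfin (ae_of_all _ fun y => imhAcceptE_le_one w z.1 y), lintegral_const, measure_univ, mul_one]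
  rfl

/-! ## §2 The disagreement probability at every time, with atoms -/

/-- **`(μ̂₀K̂ⁿ)(Δᶜ) = (1 − A(x))ⁿ·μ̂₀(Δᶜ)` FOR EVERY `n`, EVERY PROPOSAL LAW**: ordered start (`μ̂₀{w(X′_0) ≤ w(X_0)} = 1`) whose
off-diagonal part has its first run at `x` (`μ̂₀{X_0 ≠ X′_0, X_0 ≠ x} = 0`). [ours] -/
theorem iterate_bind_crnPair_offDiagonal_eq_holding_atoms [MeasurableEq Ω] (hw : Measurable w) (hw0 : ∀ y, 0 < w y)
    (Khat : Kernel (Ω × Ω) (Ω × Ω)) [IsMarkovKernel Khat]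
    (hK : ∀ z : Ω × Ω, Khat z = (q.prod (volume : Measure unitInterval)).map (fun p : Ω × unitInterval =>
      ((if (p.2 : ℝ) * w z.1 ≤ w p.1 then p.1 else z.1), (if (p.2 : ℝ) * w z.2 ≤ w p.1 then p.1 else z.2))))
    {x : Ω} :
    ∀ (n : ℕ) (μ₀ : Measure (Ω × Ω)) [IsProbabilityMeasure μ₀], μ₀ {p : Ω × Ω | w p.2 ≤ w p.1} = 1 →
      μ₀ {p : Ω × Ω | p.1 ≠ p.2 ∧ p.1 ≠ x} = 0 →
        ((fun m : Measure (Ω × Ω) => m.bind Khat)^[n] μ₀) (Set.diagonal Ω)ᶜ = (1 - imhAcceptMass q w x) ^ n * μ₀ (Set.diagonal Ω)ᶜ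
  | 0, μ₀, _, _, _ => by simp
  | n + 1, μ₀, _, hord, h0 => by
    haveI : IsProbabilityMeasure (μ₀.bind Khat) :=
      ⟨by rw [Measure.bind_apply MeasurableSet.univ (Kernel.aemeasurable _)]; simp⟩
    have hD : MeasurableSet (Set.diagonal Ω) := measurableSet_diagonal
    have hO : MeasurableSet {p : Ω × Ω | w p.2 ≤ w p.1} := measurableSet_le (hw.comp measurable_snd) (hw.comp measurable_fst)
    -- one step: `(μ₀K̂)(Δᶜ) = (1 − A(x))·μ₀(Δᶜ)`
    have hone : (μ₀.bind Khat) (Set.diagonal Ω)ᶜ = (1 - imhAcceptMass q w x) * μ₀ (Set.diagonal Ω)ᶜ := by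
      rw [Measure.bind_apply hD.compl (Kernel.aemeasurable _)]
      have hae : ∀ᵐ z ∂μ₀, Khat z (Set.diagonal Ω)ᶜ = (Set.diagonal Ω)ᶜ.indicator (fun _ => 1 - imhAcceptMass q w x) z := by
        have h1 : ∀ᵐ z ∂μ₀, z ∈ {p : Ω × Ω | w p.2 ≤ w p.1} :=
          (ae_iff_measure_eq hO.nullMeasurableSet).2 (by rw [hord, measure_univ])
        have h2 : ∀ᵐ z ∂μ₀, z ∉ {p : Ω × Ω | p.1 ≠ p.2 ∧ p.1 ≠ x} := measure_eq_zero_iff_ae_notMem.1 h0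
        filter_upwards [h1, h2] with z hz1 hz2
        simp only [not_and, not_not] at hz1 hz2
        by_cases hd : z.1 = z.2
        · have hz : z = (z.1, z.1) := Prod.ext rfl hd.symm
          have hmem : z ∉ (Set.diagonal Ω)ᶜ := fun h => h (Set.mem_diagonal_iff.2 hd)
          rw [Set.indicator_of_notMem hmem, hz]
          exact crnPair_diag_offDiagonal_eq_zero hw hw0 Khat hK z.1
        · have hmem : z ∈ (Set.diagonal Ω)ᶜ := fun h => hd (Set.mem_diagonal_iff.1 h)
          rw [Set.indicator_of_mem hmem, crnPair_apply_offDiagonal_eq_of_ordered hw hw0 Khat hK hd hz1, hz2 hd]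
      rw [lintegral_congr_ae hae, lintegral_indicator_const hD.compl]
    rw [Function.iterate_succ_apply,
      iterate_bind_crnPair_offDiagonal_eq_holding_atoms hw hw0 Khat hK n (μ₀.bind Khat)
        (bind_crnPair_weightOrder hw hw0 Khat hK μ₀ hord)
        (by simpa using iterate_bind_crnPair_offDiagonal_fst_ne_eq_zero hw hw0 Khat hK 1 μ₀ hord h0),
      hone, pow_succ, mul_assoc]

/-- **FIRST RUN AT `x`, SECOND RUN LIGHTER OR EQUAL**: `(μ̂₀K̂ⁿ)(Δᶜ) = (1 − A(x))ⁿ·P(X′_0 ≠ x)` for every `n` and EVERY proposal law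
(`MeasurableSingletonClass Ω` for the singleton `{x}`). [ours] -/
theorem iterate_bind_crnPair_offDiagonal_eq_holding_atoms' [MeasurableSingletonClass Ω] [MeasurableEq Ω] (hw : Measurable w)
    (hw0 : ∀ y, 0 < w y) {x : Ω} (Khat : Kernel (Ω × Ω) (Ω × Ω)) [IsMarkovKernel Khat]
    (hK : ∀ z : Ω × Ω, Khat z = (q.prod (volume : Measure unitInterval)).map (fun p : Ω × unitInterval =>
      ((if (p.2 : ℝ) * w z.1 ≤ w p.1 then p.1 else z.1), (if (p.2 : ℝ) * w z.2 ≤ w p.1 then p.1 else z.2))))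
    (n : ℕ) (μ₀ : Measure (Ω × Ω)) [IsProbabilityMeasure μ₀] (hfst : μ₀.map Prod.fst = Measure.dirac x)
    (hord : μ₀ {p : Ω × Ω | w p.2 ≤ w p.1} = 1) :
    ((fun m : Measure (Ω × Ω) => m.bind Khat)^[n] μ₀) (Set.diagonal Ω)ᶜ = (1 - imhAcceptMass q w x) ^ n * (μ₀.map Prod.snd) {x}ᶜ := by
  -- a.s. the first run starts at `x`
  have hfst0 : μ₀ {p : Ω × Ω | p.1 ≠ x} = 0 := by
    have : μ₀ {p : Ω × Ω | p.1 ≠ x} = (μ₀.map Prod.fst) {x}ᶜ := by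
      rw [Measure.map_apply measurable_fst (measurableSet_singleton x).compl]; rfl
    rw [this, hfst, Measure.dirac_apply' _ (measurableSet_singleton x).compl]
    simp
  have h0 : μ₀ {p : Ω × Ω | p.1 ≠ p.2 ∧ p.1 ≠ x} = 0 := measure_mono_null (fun p hp => hp.2) hfst0
  rw [iterate_bind_crnPair_offDiagonal_eq_holding_atoms hw hw0 Khat hK n μ₀ hord h0]
  congr 1
  -- `μ̂₀(Δᶜ) = P(X′_0 ≠ x)` since `X_0 = x` a.s.
  have hae : ∀ᵐ p ∂μ₀, p.1 = x := by
    have := measure_eq_zero_iff_ae_notMem.1 hfst0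
    filter_upwards [this] with p hp
    simpa using hp
  rw [Measure.map_apply measurable_snd (measurableSet_singleton x).compl]
  refine measure_congr ?_
  filter_upwards [hae] with p hp
  change (p ∈ (Set.diagonal Ω)ᶜ) = (p ∈ Prod.snd ⁻¹' ({x} : Set Ω)ᶜ)
  simp only [eq_iff_iff, Set.mem_compl_iff, Set.mem_diagonal_iff, Set.mem_preimage, Set.mem_singleton_iff, hp]
  exact ⟨fun h h' => h h'.symm, fun h h' => h h'.symm⟩

/-! ## §3 The expected total disagreement time and the tail law -/

/-- **`Σ_n (μ̂₀K̂ⁿ)(Δᶜ) = μ̂₀(Δᶜ)·A(x)⁻¹`** (`ℝ≥0∞`), EVERY PROPOSAL LAW: the expected number of updates on which two runs from an ordered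
start with heavier run at `x` differ is `P(X_0 ≠ X′_0)/A(x)`. [ours] -/
theorem tsum_iterate_bind_crnPair_offDiagonal_eq_atoms [MeasurableEq Ω] (hw : Measurable w) (hw0 : ∀ y, 0 < w y)
    (Khat : Kernel (Ω × Ω) (Ω × Ω)) [IsMarkovKernel Khat]
    (hK : ∀ z : Ω × Ω, Khat z = (q.prod (volume : Measure unitInterval)).map (fun p : Ω × unitInterval =>
      ((if (p.2 : ℝ) * w z.1 ≤ w p.1 then p.1 else z.1), (if (p.2 : ℝ) * w z.2 ≤ w p.1 then p.1 else z.2))))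
    {x : Ω} (μ₀ : Measure (Ω × Ω)) [IsProbabilityMeasure μ₀] (hord : μ₀ {p : Ω × Ω | w p.2 ≤ w p.1} = 1)
    (h0 : μ₀ {p : Ω × Ω | p.1 ≠ p.2 ∧ p.1 ≠ x} = 0) :
    ∑' n, ((fun m : Measure (Ω × Ω) => m.bind Khat)^[n] μ₀) (Set.diagonal Ω)ᶜ = μ₀ (Set.diagonal Ω)ᶜ * (imhAcceptMass q w x)⁻¹ := by
  simp_rw [iterate_bind_crnPair_offDiagonal_eq_holding_atoms hw hw0 Khat hK _ μ₀ hord h0]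
  rw [ENNReal.tsum_mul_right, ENNReal.tsum_geometric, ENNReal.sub_sub_cancel ENNReal.one_ne_top (imhAcceptMass_le_one q w x), mul_comm]

/-- **THE TAIL LAW WITH ATOMS**: `w` normalised and maximal at some `x₀` (automatic for a finite gauge group); ordered start with heavier
run at `x`; then `P(T ≥ t) = (1 − A(x))^{t−1}·μ̂₀(Δᶜ)` for every `t ≥ 1` (GEN-39's every-coupling tail identity). [ours] -/
theorem crn_chain_totalDisagreement_tail_eq_twoStarts_atoms [MeasurableEq Ω] (hw : Measurable w) (hw0 : ∀ y, 0 < w y) {x₀ : Ω}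
    (hmax : ∀ y, w y ≤ w x₀) [IsProbabilityMeasure (q.withDensity fun y => ENNReal.ofReal (w y))]
    (Khat : Kernel (Ω × Ω) (Ω × Ω)) [IsMarkovKernel Khat]
    (hK : ∀ z : Ω × Ω, Khat z = (q.prod (volume : Measure unitInterval)).map (fun p : Ω × unitInterval =>
      ((if (p.2 : ℝ) * w z.1 ≤ w p.1 then p.1 else z.1), (if (p.2 : ℝ) * w z.2 ≤ w p.1 then p.1 else z.2))))
    {x : Ω} (μ₀ : Measure (Ω × Ω)) [IsProbabilityMeasure μ₀] (hord : μ₀ {p : Ω × Ω | w p.2 ≤ w p.1} = 1)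
    (h0 : μ₀ {p : Ω × Ω | p.1 ≠ p.2 ∧ p.1 ≠ x} = 0) {t : ℕ} (ht : 1 ≤ t) :
    (Kernel.trajMeasure (X := fun _ : ℕ => Ω × Ω) μ₀
          (fun n : ℕ => Khat.comap (fun h : (i : ↥(Finset.Iic n)) → Ω × Ω => h ⟨n, Finset.mem_Iic.2 le_rfl⟩)
            (measurable_pi_apply _))).real
        {z | (t : ℝ) ≤ ∑' n, (Set.diagonal Ω)ᶜ.indicator (1 : Ω × Ω → ℝ) (z n)} =
      (1 - (imhAcceptMass q w x).toReal) ^ (t - 1) * μ₀.real (Set.diagonal Ω)ᶜ := by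
  rw [crn_chain_totalDisagreement_tail_eq hw hw0 hmax Khat hK μ₀ ht, measureReal_def,
    iterate_bind_crnPair_offDiagonal_eq_holding_atoms hw hw0 Khat hK (t - 1) μ₀ hord h0, ENNReal.toReal_mul, ENNReal.toReal_pow,
    ENNReal.toReal_sub_of_le (imhAcceptMass_le_one q w x) ENNReal.one_ne_top, ENNReal.toReal_one, measureReal_def]

end Summit.Ventures.LatticeQCDFlow.Exactness

end
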